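import Literature.MathematicalPhysics.QuantumFieldTheory.BalabanImbrieJaffe1984to88.BIJ85GaugeFunction5113
import Literature.MathematicalPhysics.QuantumFieldTheory.BalabanImbrieJaffe1984to88.BIJ85CurlQsstar

/-!
# `BalabanImbrieJaffe1984to88.BIJ85ContourLocality` — T. Bałaban, J. Imbrie, A. Jaffe, *Renormalization of the Higgs model:
minimizers, propagators and the stability of mean field theory*, Commun. Math. Phys. **97** (1985) 299–329 [BalabanImbrieJaffe1985]:
the LOCALITY and the SUP-BOUNDS of the contour functionals of (5.1.4)/(5.1.13) pp. 314–315 — `(Q_jA)(Γ_{x_{j+1},x_j})`, its block mean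
`Q′(Q_jA)(Γ_{x_{j+1},·})` (5.1.11) and their bracket — and of the iterated averages `Q_j` of (2.13) ([Balaban1984PropagatorsI] (1.18)) on
the tori of the series' lattice calculus (file 1 of 2 of the row C1.Eq7.2.4; file 2 = `BIJ85Ineq724Proof`: the gauge function λ of
(5.1.4) is bounded and (7.2.2) ⇒ (7.2.4))

statement-level skeleton of published theorems with citation tags; proofs where landed; nothing here is a claim about the Yang–Mills mass gap

PDF held: `paper:balaban1985-cmp97-bij-higgs-minimizers` (journal page = PDF page + 298); pp. 313–315 [PDF 15–17] read as images on
`run/shared/lean/pub/lit-balaban/lit-balaban-p08/renders/bij85-p016.png`, `…-p017.png`, p. 326 [PDF 28] on the OCR text layer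
(`lit read paper:balaban1985-cmp97-bij-higgs-minimizers --pages 28`); [6I] = [Balaban1984PropagatorsI] (1.7), (1.11), (1.18) pp. 18–20.

CITATION HEADER (lean-in-tree rule).  Phase-2 file of the lit-balaban TYPED SKELETON (HOME `run/shared/lean/pub/lit-balaban/`), seat
p03 gen 2 (unit `lit-balaban-p03`), in support of SKELETON row **C1.Eq7.2.4** ((7.2.4) p. 326: *"The gauge transformation λ in (5.1.1) is
bounded and depends on B through an exponentially decaying kernel D_k … This estimate follows from (5.1.4) and (7.2.2)"*).  The printed
"follows from (5.1.4)" rests on two facts about the formula (5.1.4) = (5.1.13) for λ, verbatim p. 314: *"The contour Γ_{x_j,x} runs from x to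
x₁ in B(x₁), from x₁ to x₂ in B(x₂), etc."* and p. 304 (the average (2.13)): *"bonds entering: the interiors of B(b′₋), B(b′₊) and the surface
bonds between them"* — i.e. every ingredient of λ(x) is LOCAL (lives in the block tower of x) and is an AVERAGE or a SUM OF ≤ dL bond values.
WHAT IS PROVED HERE, on the carriers OF RECORD (`Balaban1983to89.LatticeFieldCalculus`: tori `Site P j`, staircase `stairSum` = `A(Γ_{y,x})`
of [6I] (1.7), `bondAvg`/`bondAvgIter` = `Q`/`Q_k` of [6I] (1.11)/(1.18), centred blocks `blockOf`/`emb`/`Site.blockSite`; the concrete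
objects of (5.1.4) are `…BIJ85GaugeFunction5113.contour`/`blockMean`/`fluct`, seat p08 gen 2), standing range `j + 1 ≤ m + K`:
* §1 — block-site arithmetic (private, folklore): the staircase corner, backward moves, the signed displacement inside a block; the forward moves
  and the block of `x + te_μ` are REUSED from `…BIJ85Eq219Proof` / `…BIJ85CurlQsstar` (seat p31), not restated;
* §2 — **the staircase `Γ_{q,s}` between two sites of one block `B(y)` visits only bonds with both endpoints in `B(y)`**: LOCALITY
  `stairSum_blockSite_congr` (two bond fields agreeing on the bonds of `B(y)` have the same `A(Γ_{q,s})`) and the BOUND `norm_stairSum_blockSite_le`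
  (`‖A(Γ_{q,s})‖ ≤ d·L·sup_{B(y)}‖A‖`);
* §3 — the same for the contour functional `A(Γ_{z₊,z})` of (5.1.4) (`contour_congr_block`, `norm_contour_le`), its block mean (5.1.11)
  (`blockMean_eq_sum_blockSite`, `blockMean_congr_block`, `norm_blockMean_le`) and the bracket of (5.1.13) (`fluct_congr_block`,
  `norm_fluct_le`: `≤ 2dL·sup`);
* §4 — **locality and contractivity of the iterated average `Q_n`** along block towers: `bondAvgIter_congr_tower` (the values `(Q_nA)(c)` on
  bonds with both endpoints in a set `S ⊂ T^{(n)}` only see `A` on the fine bonds with both endpoints in the tower over `S`) and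
  `norm_bondAvgIter_le_tower` (`sup_S‖Q_nA‖ ≤ sup_tower‖A‖`: each `Q` is an average of `L^{d+1}` terms with weight `L^{−(d+1)}`).
No definition, no new Prop-valued fact; nothing of the paper is asserted beyond the kernel-checked lattice combinatorics.  Unit `lit-balaban-p03`.
-/

namespace Literature.MathematicalPhysics.QuantumFieldTheory.BalabanImbrieJaffe1984to88.BIJ85ContourLocality

open Literature.MathematicalPhysics.QuantumFieldTheory.Balaban1983to89
open LatticeFieldCalculus BIJ85GaugeFunction5113

/-! ## §1  Block sites of the centred blocks: corners, backward moves, signed displacements (standing range) -/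

section Geometry

variable {P : Params} {j : ℕ}

/-- In the standing range every direction of `T^{(j)}` (`j < m + K`) has at least `2L` sites. [folklore] -/
private theorem two_mul_L_le_sitesPerDir (hj : j + 1 ≤ P.m + P.K) : 2 * P.L ≤ P.sitesPerDir j := by
  unfold Params.sitesPerDir
  have h : 1 ≤ P.m + P.K - j := by omega
  calc 2 * P.L = 2 * P.L ^ 1 := by ring
    _ ≤ 2 * P.L ^ (P.m + P.K - j) := Nat.mul_le_mul_left _ (Nat.pow_le_pow_right P.L_pos h)

/-- Coordinates of a block site: label `y_ν L + r_ν`. [folklore] -/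
private theorem blockSite_apply (y : Site P (j + 1)) (r : Fin P.d → Fin P.L) (ν : Fin P.d) :
    Site.blockSite y r ν = (((y ν).val * P.L + r ν : ℕ) : ZMod (P.sitesPerDir j)) := rfl

/-- The block centre `emb y` is the block site with all offsets `(L−1)/2`. [folklore] -/
private theorem emb_eq_blockSite (y : Site P (j + 1)) :
    emb y = Site.blockSite y (fun _ => ⟨(P.L - 1) / 2, AveragingRT.half_lt P⟩) := rfl

/-- Moving `t ≤ r_μ` steps backward in the direction `μ` inside the block: offset `r_μ ↦ r_μ − t`. [folklore] -/
private theorem update_blockSite_sub (y : Site P (j + 1)) (r : Fin P.d → Fin P.L) (μ : Fin P.d) (t : ℕ) (h : t ≤ (r μ : ℕ)) :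
    Function.update (Site.blockSite y r) μ (Site.blockSite y r μ - (t : ZMod (P.sitesPerDir j)))
      = Site.blockSite y (Function.update r μ ⟨r μ - t, by omega⟩) := by
  funext ν
  by_cases hν : ν = μ
  · subst hν
    simp only [Function.update_self, blockSite_apply]
    have : (y ν).val * P.L + (r ν : ℕ) = ((y ν).val * P.L + ((r ν : ℕ) - t)) + t := by omega
    rw [this]
    push_cast
    ring
  · simp only [Function.update_of_ne hν, blockSite_apply]

/-- The corner of the staircase between two block sites is a block site (the mixed offsets). [folklore] -/
private theorem mixSite_blockSite (μ : Fin P.d) (y : Site P (j + 1)) (q s : Fin P.d → Fin P.L) :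
    mixSite μ (Site.blockSite y q) (Site.blockSite y s) = Site.blockSite y (fun ν => if μ < ν then s ν else q ν) := by
  funext ν
  simp only [mixSite, blockSite_apply]
  split_ifs <;> rfl

/-- The signed displacement between two sites of one block is the difference of their offsets (no wrap-around: `|s − q| ≤ L − 1`
and a direction has `≥ 2L` sites). [folklore] -/
private theorem valMinAbs_blockSite_sub (hj : j + 1 ≤ P.m + P.K) (y : Site P (j + 1)) (q s : Fin P.d → Fin P.L) (μ : Fin P.d) :
    (Site.blockSite y s μ - Site.blockSite y q μ).valMinAbs = (s μ : ℤ) - (q μ : ℤ) := by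
  rw [ZMod.valMinAbs_spec]
  refine ⟨?_, ?_⟩
  · simp only [blockSite_apply]
    push_cast
    ring
  · have hN := two_mul_L_le_sitesPerDir hj
    have hs := (s μ).isLt
    have hq := (q μ).isLt
    simp only [Set.mem_Ioc]
    constructor <;> omega

end Geometry

/-! ## §2  The staircase contour `Γ_{y,x}` inside one block: locality and the bound by the number of its bonds -/

section Staircase

variable {P : Params} {j : ℕ} {V : Type*} [AddCommGroup V] {W : Type*} [NormedAddCommGroup W]

/-- LOCALITY of `F(Γ_{q,s})` inside a block: the staircase sum between two sites of `B(y)` only sees bonds with both endpoints in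
`B(y)` ([Balaban1984PropagatorsI] (1.7): the contour changes one coordinate at a time, monotonically). [cite: Balaban1984PropagatorsI, (1.7) p.18] -/
theorem stairSum_blockSite_congr (hj : j + 1 ≤ P.m + P.K) {F F' : VecField P j V} (y : Site P (j + 1))
    (h : ∀ b : PBond P j, blockOf b.src = y → blockOf b.tgt = y → F b = F' b) (q s : Fin P.d → Fin P.L) :
    stairSum F (Site.blockSite y q) (Site.blockSite y s) = stairSum F' (Site.blockSite y q) (Site.blockSite y s) := by
  unfold stairSum
  refine Finset.sum_congr rfl fun μ _ => ?_
  rw [mixSite_blockSite, valMinAbs_blockSite_sub hj]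
  set r : Fin P.d → Fin P.L := fun ν => if μ < ν then s ν else q ν with hr
  have hrμ : (r μ : ℕ) = q μ := by simp [hr]
  by_cases hqs : (q μ : ℕ) ≤ s μ
  · have hn : ((s μ : ℕ) : ℤ) - ((q μ : ℕ) : ℤ) = (((s μ : ℕ) - q μ : ℕ) : ℤ) := by omega
    rw [hn, runSum_ofNat, runSum_ofNat]
    unfold segSum
    refine Finset.sum_congr rfl fun t ht => ?_
    have ht' := Finset.mem_range.mp ht
    have h1 : (r μ : ℕ) + t < P.L := by have := (s μ).isLt; omega
    have h2 : ((Function.update r μ ⟨r μ + t, h1⟩ μ : Fin P.L) : ℕ) + 1 < P.L := by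
      simp only [Function.update_self]; have := (s μ).isLt; omega
    apply h
    · show blockOf (runSite (Site.blockSite y r) μ t) = y
      rw [BIJ85Eq219Proof.runSite_blockSite_of_lt y r μ h1, Site.blockOf_blockSite hj]
    · show blockOf ((runSite (Site.blockSite y r) μ t).shift μ) = y
      rw [BIJ85Eq219Proof.runSite_blockSite_of_lt y r μ h1, BIJ85CurlQsstar.shift_blockSite_of_lt _ _ _ h2, Site.blockOf_blockSite hj]
  · rw [not_le] at hqs
    have hn : ((s μ : ℕ) : ℤ) - ((q μ : ℕ) : ℤ) = Int.negSucc ((q μ : ℕ) - s μ - 1) := by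
      rw [Int.negSucc_eq]; omega
    rw [hn]
    simp only [runSum]
    congr 1
    refine Finset.sum_congr rfl fun t ht => ?_
    have ht' := Finset.mem_range.mp ht
    have h1 : t + 1 ≤ (r μ : ℕ) := by omega
    have h2 : ((Function.update r μ ⟨r μ - (t + 1), by omega⟩ μ : Fin P.L) : ℕ) + 1 < P.L := by
      simp only [Function.update_self]; have := (q μ).isLt; omega
    apply h
    · show blockOf (Function.update (Site.blockSite y r) μ
        (Site.blockSite y r μ - ((t + 1 : ℕ) : ZMod (P.sitesPerDir j)))) = y
      rw [update_blockSite_sub y r μ (t + 1) h1, Site.blockOf_blockSite hj]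
    · show blockOf (Site.shift (Function.update (Site.blockSite y r) μ
        (Site.blockSite y r μ - ((t + 1 : ℕ) : ZMod (P.sitesPerDir j)))) μ) = y
      rw [update_blockSite_sub y r μ (t + 1) h1, BIJ85CurlQsstar.shift_blockSite_of_lt _ _ _ h2, Site.blockOf_blockSite hj]

/-- THE BOUND BY THE LENGTH: if `‖F(b)‖ ≤ a` on the bonds of `B(y)`, then `‖F(Γ_{q,s})‖ ≤ d·L·a` for `q, s ∈ B(y)` (the staircase has
at most `L − 1` bonds per direction). [cite: Balaban1984PropagatorsI, (1.7) p.18] -/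
theorem norm_stairSum_blockSite_le (hj : j + 1 ≤ P.m + P.K) {F : VecField P j W} (y : Site P (j + 1)) {a : ℝ}
    (ha : 0 ≤ a) (h : ∀ b : PBond P j, blockOf b.src = y → blockOf b.tgt = y → ‖F b‖ ≤ a) (q s : Fin P.d → Fin P.L) :
    ‖stairSum F (Site.blockSite y q) (Site.blockSite y s)‖ ≤ P.d * P.L * a := by
  unfold stairSum
  have hL0 : (0 : ℝ) ≤ P.L := Nat.cast_nonneg _
  have key : ∀ μ : Fin P.d,
      ‖runSum F (mixSite μ (Site.blockSite y q) (Site.blockSite y s)) μ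
          (Site.blockSite y s μ - Site.blockSite y q μ).valMinAbs‖ ≤ P.L * a := by
    intro μ
    rw [mixSite_blockSite, valMinAbs_blockSite_sub hj]
    set r : Fin P.d → Fin P.L := fun ν => if μ < ν then s ν else q ν with hr
    have hrμ : (r μ : ℕ) = q μ := by simp [hr]
    by_cases hqs : (q μ : ℕ) ≤ s μ
    · have hn : ((s μ : ℕ) : ℤ) - ((q μ : ℕ) : ℤ) = (((s μ : ℕ) - q μ : ℕ) : ℤ) := by omega
      rw [hn, runSum_ofNat]
      unfold segSum
      have hcard : (((s μ : ℕ) - q μ : ℕ) : ℝ) ≤ P.L := by have := (s μ).isLt; exact_mod_cast (by omega)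
      calc ‖∑ t ∈ Finset.range ((s μ : ℕ) - q μ), F (runBond (Site.blockSite y r) μ t)‖
          ≤ ∑ t ∈ Finset.range ((s μ : ℕ) - q μ), a := norm_sum_le_of_le _ fun t ht => ?_
        _ = (((s μ : ℕ) - q μ : ℕ) : ℝ) * a := by rw [Finset.sum_const, Finset.card_range, nsmul_eq_mul]
        _ ≤ P.L * a := mul_le_mul_of_nonneg_right hcard ha
      have ht' := Finset.mem_range.mp ht
      have h1 : (r μ : ℕ) + t < P.L := by have := (s μ).isLt; omega
      have h2 : ((Function.update r μ ⟨r μ + t, h1⟩ μ : Fin P.L) : ℕ) + 1 < P.L := by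
        simp only [Function.update_self]; have := (s μ).isLt; omega
      apply h
      · show blockOf (runSite (Site.blockSite y r) μ t) = y
        rw [BIJ85Eq219Proof.runSite_blockSite_of_lt y r μ h1, Site.blockOf_blockSite hj]
      · show blockOf ((runSite (Site.blockSite y r) μ t).shift μ) = y
        rw [BIJ85Eq219Proof.runSite_blockSite_of_lt y r μ h1, BIJ85CurlQsstar.shift_blockSite_of_lt _ _ _ h2, Site.blockOf_blockSite hj]
    · rw [not_le] at hqs
      have hn : ((s μ : ℕ) : ℤ) - ((q μ : ℕ) : ℤ) = Int.negSucc ((q μ : ℕ) - s μ - 1) := by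
        rw [Int.negSucc_eq]; omega
      rw [hn]
      simp only [runSum, norm_neg]
      have hcard : (((q μ : ℕ) - s μ - 1 + 1 : ℕ) : ℝ) ≤ P.L := by have := (q μ).isLt; exact_mod_cast (by omega)
      calc ‖∑ t ∈ Finset.range ((q μ : ℕ) - s μ - 1 + 1), F ⟨Function.update (Site.blockSite y r) μ
              (Site.blockSite y r μ - ((t + 1 : ℕ) : ZMod (P.sitesPerDir j))), μ⟩‖
          ≤ ∑ t ∈ Finset.range ((q μ : ℕ) - s μ - 1 + 1), a := norm_sum_le_of_le _ fun t ht => ?_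
        _ = (((q μ : ℕ) - s μ - 1 + 1 : ℕ) : ℝ) * a := by rw [Finset.sum_const, Finset.card_range, nsmul_eq_mul]
        _ ≤ P.L * a := mul_le_mul_of_nonneg_right hcard ha
      have ht' := Finset.mem_range.mp ht
      have h1 : t + 1 ≤ (r μ : ℕ) := by omega
      have h2 : ((Function.update r μ ⟨r μ - (t + 1), by omega⟩ μ : Fin P.L) : ℕ) + 1 < P.L := by
        simp only [Function.update_self]; have := (q μ).isLt; omega
      apply h
      · show blockOf (Function.update (Site.blockSite y r) μ
          (Site.blockSite y r μ - ((t + 1 : ℕ) : ZMod (P.sitesPerDir j)))) = y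
        rw [update_blockSite_sub y r μ (t + 1) h1, Site.blockOf_blockSite hj]
      · show blockOf (Site.shift (Function.update (Site.blockSite y r) μ
          (Site.blockSite y r μ - ((t + 1 : ℕ) : ZMod (P.sitesPerDir j)))) μ) = y
        rw [update_blockSite_sub y r μ (t + 1) h1, BIJ85CurlQsstar.shift_blockSite_of_lt _ _ _ h2, Site.blockOf_blockSite hj]
  calc ‖∑ μ : Fin P.d, runSum F (mixSite μ (Site.blockSite y q) (Site.blockSite y s)) μ
          (Site.blockSite y s μ - Site.blockSite y q μ).valMinAbs‖
      ≤ ∑ μ : Fin P.d, (P.L : ℝ) * a := norm_sum_le_of_le _ fun μ _ => key μ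
    _ = P.d * P.L * a := by
      rw [Finset.sum_const, Finset.card_univ, Fintype.card_fin, nsmul_eq_mul]; ring

end Staircase

/-! ## §3  The contour functionals of (5.1.4)/(5.1.13): `(Q_jA)(Γ_{x_{j+1},x_j})`, the block mean (5.1.11), the bracket -/

section Contour

variable {P : Params} {j : ℕ} {V : Type*} [AddCommGroup V] {W : Type*} [NormedAddCommGroup W]

/-- LOCALITY of the contour functional `F(Γ_{z₊,z})` of (5.1.4): it only sees the bonds of the block `B(z₊)`, `z₊ = blockOf z`
(*"The contour Γ_{x_j,x} runs from x to x₁ in B(x₁), from x₁ to x₂ in B(x₂), etc."*, p. 314). [cite: BalabanImbrieJaffe1985, (5.1.3)–(5.1.4) p.314] -/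
theorem contour_congr_block (hj : j + 1 ≤ P.m + P.K) {F F' : VecField P j V} (z : Site P j)
    (h : ∀ b : PBond P j, blockOf b.src = blockOf z → blockOf b.tgt = blockOf z → F b = F' b) :
    contour F z = contour F' z := by
  obtain ⟨s, hs⟩ := exists_blockSite_eq hj z
  unfold contour
  generalize hy : blockOf z = y at hs h
  subst hs
  rw [emb_eq_blockSite]
  exact stairSum_blockSite_congr hj y h _ _

/-- BOUNDEDNESS of the contour functional: `‖F(Γ_{z₊,z})‖ ≤ d·L·sup_{B(z₊)}‖F‖`. [cite: BalabanImbrieJaffe1985, (5.1.4) p.314] -/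
theorem norm_contour_le (hj : j + 1 ≤ P.m + P.K) {F : VecField P j W} (z : Site P j) {a : ℝ} (ha : 0 ≤ a)
    (h : ∀ b : PBond P j, blockOf b.src = blockOf z → blockOf b.tgt = blockOf z → ‖F b‖ ≤ a) :
    ‖contour F z‖ ≤ P.d * P.L * a := by
  obtain ⟨s, hs⟩ := exists_blockSite_eq hj z
  unfold contour
  generalize hy : blockOf z = y at hs h
  subst hs
  rw [emb_eq_blockSite]
  exact norm_stairSum_blockSite_le hj y ha h _ _

variable [Module ℝ V] [NormedSpace ℝ W]

/-- The block mean `Q′(F(Γ_{y,·}))(y)` of (5.1.11) unfolded over the block sites of `B(y)`. [cite: BalabanImbrieJaffe1985, (5.1.11) p.315] -/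
theorem blockMean_eq_sum_blockSite (hj : j + 1 ≤ P.m + P.K) (F : VecField P j V) (y : Site P (j + 1)) :
    blockMean F y = (((P.L : ℝ) ^ P.d)⁻¹) • ∑ r : Fin P.d → Fin P.L,
      stairSum F (Site.blockSite y (fun _ => ⟨(P.L - 1) / 2, AveragingRT.half_lt P⟩)) (Site.blockSite y r) := by
  unfold blockMean siteAvg contour
  congr 1
  refine Finset.sum_congr rfl fun r _ => ?_
  rw [Site.blockOf_blockSite hj, emb_eq_blockSite]

/-- LOCALITY of the block mean `Q′(F(Γ_{y,·}))(y)`: it only sees the bonds of `B(y)`. [cite: BalabanImbrieJaffe1985, (5.1.11) p.315] -/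
theorem blockMean_congr_block (hj : j + 1 ≤ P.m + P.K) {F F' : VecField P j V} (y : Site P (j + 1))
    (h : ∀ b : PBond P j, blockOf b.src = y → blockOf b.tgt = y → F b = F' b) :
    blockMean F y = blockMean F' y := by
  rw [blockMean_eq_sum_blockSite hj, blockMean_eq_sum_blockSite hj]
  congr 1
  exact Finset.sum_congr rfl fun r _ => stairSum_blockSite_congr hj y h _ _

/-- BOUNDEDNESS of the block mean: `‖Q′(F(Γ_{y,·}))(y)‖ ≤ d·L·sup_{B(y)}‖F‖` (an average of `L^d` contour functionals).
[cite: BalabanImbrieJaffe1985, (5.1.11) p.315] -/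
theorem norm_blockMean_le (hj : j + 1 ≤ P.m + P.K) {F : VecField P j W} (y : Site P (j + 1)) {a : ℝ} (ha : 0 ≤ a)
    (h : ∀ b : PBond P j, blockOf b.src = y → blockOf b.tgt = y → ‖F b‖ ≤ a) :
    ‖blockMean F y‖ ≤ P.d * P.L * a := by
  rw [blockMean_eq_sum_blockSite hj]
  have hLd : (0 : ℝ) < (P.L : ℝ) ^ P.d := pow_pos (Nat.cast_pos.mpr P.L_pos) _
  rw [norm_smul, norm_inv, Real.norm_eq_abs, abs_of_pos hLd]
  have hsum : ‖∑ r : Fin P.d → Fin P.L, stairSum F (Site.blockSite y (fun _ => ⟨(P.L - 1) / 2, AveragingRT.half_lt P⟩))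
      (Site.blockSite y r)‖ ≤ (P.L : ℝ) ^ P.d * (P.d * P.L * a) := by
    calc _ ≤ ∑ r : Fin P.d → Fin P.L, (P.d : ℝ) * P.L * a :=
          norm_sum_le_of_le _ fun r _ => norm_stairSum_blockSite_le hj y ha h _ _
      _ = (P.L : ℝ) ^ P.d * (P.d * P.L * a) := by
        rw [Finset.sum_const, Finset.card_univ, Fintype.card_fun, Fintype.card_fin, Fintype.card_fin, nsmul_eq_mul]
        push_cast
        ring
  calc ((P.L : ℝ) ^ P.d)⁻¹ * ‖∑ r : Fin P.d → Fin P.L, stairSum F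
        (Site.blockSite y (fun _ => ⟨(P.L - 1) / 2, AveragingRT.half_lt P⟩)) (Site.blockSite y r)‖
      ≤ ((P.L : ℝ) ^ P.d)⁻¹ * ((P.L : ℝ) ^ P.d * (P.d * P.L * a)) :=
        mul_le_mul_of_nonneg_left hsum (inv_nonneg.mpr hLd.le)
    _ = P.d * P.L * a := by field_simp

/-- LOCALITY of the bracket `[(Q_jA)(Γ_{x_{j+1},x_j}) − Q′(Q_jA)(Γ_{x_{j+1},·})]` of (5.1.13): it only sees the bonds of `B(x_{j+1})`.
[cite: BalabanImbrieJaffe1985, (5.1.13) p.315] -/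
theorem fluct_congr_block (hj : j + 1 ≤ P.m + P.K) {F F' : VecField P j V} (z : Site P j)
    (h : ∀ b : PBond P j, blockOf b.src = blockOf z → blockOf b.tgt = blockOf z → F b = F' b) :
    fluct F z = fluct F' z := by
  unfold fluct
  rw [contour_congr_block hj z h, blockMean_congr_block hj (blockOf z) h]

/-- BOUNDEDNESS of the bracket of (5.1.13): `‖[…](x_j)‖ ≤ 2·d·L·sup_{B(x_{j+1})}‖Q_jA‖`. [cite: BalabanImbrieJaffe1985, (5.1.13) p.315] -/
theorem norm_fluct_le (hj : j + 1 ≤ P.m + P.K) {F : VecField P j W} (z : Site P j) {a : ℝ} (ha : 0 ≤ a)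
    (h : ∀ b : PBond P j, blockOf b.src = blockOf z → blockOf b.tgt = blockOf z → ‖F b‖ ≤ a) :
    ‖fluct F z‖ ≤ 2 * (P.d * P.L * a) := by
  unfold fluct
  calc ‖contour F z - blockMean F (blockOf z)‖ ≤ ‖contour F z‖ + ‖blockMean F (blockOf z)‖ := norm_sub_le _ _
    _ ≤ P.d * P.L * a + P.d * P.L * a := add_le_add (norm_contour_le hj z ha h) (norm_blockMean_le hj _ ha h)
    _ = 2 * (P.d * P.L * a) := by ring

end Contour

/-! ## §4  The averaging corridors: `(Q_nA)(c)` only sees the fine bonds of the block tower over `{c₋, c₊}` ([6I] (1.18)) -/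

section Tower

variable {P : Params} {j : ℕ} {V : Type*} [AddCommGroup V] [Module ℝ V] {W : Type*} [NormedAddCommGroup W] [NormedSpace ℝ W]

/-- The straight contour `[x, x(c)]` of the bond average (1.11) stays in `B(c₋) ∪ B(c₊)`: the site `x + t e_μ`, `x ∈ B(y)`, `t ≤ L`,
lies in `B(y)` or in `B(y + e_μ)` (*"bonds entering: the interiors of B(b′₋), B(b′₊)"*, [BalabanImbrieJaffe1985] p. 304).
[cite: Balaban1984PropagatorsI, (1.11) p.19] -/
private theorem blockOf_runSite_blockSite (hj : j + 1 ≤ P.m + P.K) (y : Site P (j + 1)) (r : Fin P.d → Fin P.L) (μ : Fin P.d)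
    (t : ℕ) (ht : t ≤ P.L) :
    blockOf (runSite (Site.blockSite y r) μ t) = y ∨ blockOf (runSite (Site.blockSite y r) μ t) = y.shift μ := by
  by_cases hlt : (r μ : ℕ) + t < P.L
  · left
    exact BIJ85Eq219Proof.blockOf_runSite_blockSite_of_lt hj y r μ hlt
  · right
    have := (r μ).isLt
    exact BIJ85Eq219Proof.blockOf_runSite_blockSite_of_ge hj y r μ (by omega) (by omega)

/-- **LOCALITY OF THE ITERATED AVERAGE `Q_n`** ([Balaban1984PropagatorsI] (1.18): `(Q_kA)_b = Σ_{x∈B^k(b₋)} η^{d+1}A([x, x(b)])`):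
for a set `S` of sites of `T^{(n)}`, the values `(Q_nA)(c)` on the bonds `c` with both endpoints in `S` only depend on `A` on the
fine bonds whose endpoints lie in the block tower over `S` (`blk n b₋ ∈ S`, `blk n b₊ ∈ S`). [cite: Balaban1984PropagatorsI, (1.18) p.20] -/
theorem bondAvgIter_congr_tower : ∀ (n : ℕ), n ≤ P.m + P.K → ∀ (S : Set (Site P n)) (A A' : VecField P 0 V),
    (∀ b : PBond P 0, blk n b.src ∈ S → blk n b.tgt ∈ S → A b = A' b) →
    ∀ c : PBond P n, c.src ∈ S → c.tgt ∈ S → bondAvgIter n A c = bondAvgIter n A' c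
  | 0, _, _, _, _, h, c, hs, ht => h c hs ht
  | n + 1, hn, S, A, A', h, c, hs, ht => by
    show bondAvg (bondAvgIter n A) c = bondAvg (bondAvgIter n A') c
    unfold bondAvg segSum
    congr 1
    refine Finset.sum_congr rfl fun r _ => Finset.sum_congr rfl fun t htL => ?_
    have htL' := Finset.mem_range.mp htL
    have IH := bondAvgIter_congr_tower n (by omega) {w | blockOf w ∈ S} A A' (fun b h1 h2 => h b h1 h2)
    apply IH
    · show blockOf (runSite (Site.blockSite c.src r) c.dir t) ∈ S
      rcases blockOf_runSite_blockSite hn c.src r c.dir t htL'.le with e | e <;> rw [e]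
      exacts [hs, ht]
    · show blockOf ((runSite (Site.blockSite c.src r) c.dir t).shift c.dir) ∈ S
      rw [← runSite_succ]
      rcases blockOf_runSite_blockSite hn c.src r c.dir (t + 1) (by omega) with e | e <;> rw [e]
      exacts [hs, ht]

/-- **THE ITERATED AVERAGE IS A CONTRACTION in sup-norm, locally**: if `‖A(b)‖ ≤ a` on the fine bonds of the block tower over `S`,
then `‖(Q_nA)(c)‖ ≤ a` on the bonds `c` with both endpoints in `S` (each `Q` is an average: `L^{d+1}` terms with the weight
`L^{−(d+1)}`). [cite: Balaban1984PropagatorsI, (1.18) p.20] -/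
theorem norm_bondAvgIter_le_tower : ∀ (n : ℕ), n ≤ P.m + P.K → ∀ (S : Set (Site P n)) (A : VecField P 0 W) (a : ℝ),
    (∀ b : PBond P 0, blk n b.src ∈ S → blk n b.tgt ∈ S → ‖A b‖ ≤ a) →
    ∀ c : PBond P n, c.src ∈ S → c.tgt ∈ S → ‖bondAvgIter n A c‖ ≤ a
  | 0, _, _, _, _, h, c, hs, ht => h c hs ht
  | n + 1, hn, S, A, a, h, c, hs, ht => by
    show ‖bondAvg (bondAvgIter n A) c‖ ≤ a
    unfold bondAvg segSum
    have hLd : (0 : ℝ) < (P.L : ℝ) ^ (P.d + 1) := pow_pos (Nat.cast_pos.mpr P.L_pos) _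
    rw [norm_smul, norm_inv, Real.norm_eq_abs, abs_of_pos hLd]
    have IH := norm_bondAvgIter_le_tower n (by omega) {w | blockOf w ∈ S} A a (fun b h1 h2 => h b h1 h2)
    have hterm : ∀ (r : Fin P.d → Fin P.L), ∀ t ∈ Finset.range P.L,
        ‖bondAvgIter n A (runBond (Site.blockSite c.src r) c.dir t)‖ ≤ a := by
      intro r t htL
      have htL' := Finset.mem_range.mp htL
      apply IH
      · show blockOf (runSite (Site.blockSite c.src r) c.dir t) ∈ S
        rcases blockOf_runSite_blockSite hn c.src r c.dir t htL'.le with e | e <;> rw [e]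
        exacts [hs, ht]
      · show blockOf ((runSite (Site.blockSite c.src r) c.dir t).shift c.dir) ∈ S
        rw [← runSite_succ]
        rcases blockOf_runSite_blockSite hn c.src r c.dir (t + 1) (by omega) with e | e <;> rw [e]
        exacts [hs, ht]
    have hsum : ‖∑ r : Fin P.d → Fin P.L, ∑ t ∈ Finset.range P.L,
        bondAvgIter n A (runBond (Site.blockSite c.src r) c.dir t)‖ ≤ (P.L : ℝ) ^ (P.d + 1) * a := by
      calc _ ≤ ∑ r : Fin P.d → Fin P.L, ∑ t ∈ Finset.range P.L, a :=
            norm_sum_le_of_le _ fun r _ => norm_sum_le_of_le _ fun t htL => hterm r t htL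
        _ = (P.L : ℝ) ^ (P.d + 1) * a := by
          simp only [Finset.sum_const, Finset.card_range, Finset.card_univ, Fintype.card_fun, Fintype.card_fin,
            nsmul_eq_mul]
          push_cast
          ring
    calc ((P.L : ℝ) ^ (P.d + 1))⁻¹ * ‖∑ r : Fin P.d → Fin P.L, ∑ t ∈ Finset.range P.L,
          bondAvgIter n A (runBond (Site.blockSite c.src r) c.dir t)‖
        ≤ ((P.L : ℝ) ^ (P.d + 1))⁻¹ * ((P.L : ℝ) ^ (P.d + 1) * a) :=
          mul_le_mul_of_nonneg_left hsum (inv_nonneg.mpr hLd.le)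
      _ = a := by field_simp

end Tower

end Literature.MathematicalPhysics.QuantumFieldTheory.BalabanImbrieJaffe1984to88.BIJ85ContourLocality
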